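import Mathlib

/-!
# `Balaban1983to89.B4Eq246Fibre` — [Balaban1983RegularityDecay] p. 584, (2.45) ⇒ (2.46): «Solving this equation we obtain the
# following formula» — the fibrewise solution of the Fourier-transformed basic equation, as kernel theorems (both directions)

statement-level skeleton of published theorems with citation tags; proofs where landed; nothing here is a claim about the Yang–Mills mass gap

CITATION HEADER.  T. Bałaban, *Regularity and decay of lattice Green's functions*, Commun. Math. Phys. **89** (1983) 571–597,
doi:10.1007/bf01214744 [Balaban1983RegularityDecay] (cell paper B4; held text `paper:balaban1983-cmp89-regularity-decay`, journal page =
PDF page + 570), p. 584 [PDF 14]; render `pub-balaban/b2b-balaban-ref1/pages/1983-cmp89-regularity-decay/1983-cmp89-regularity-decay-p014-x2.png`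
read as an image by this seat (unit `lit-balaban-r01` gen 42, B4 fold owner; HOME `run/shared/lean/pub/lit-balaban/`; SKELETON row
**B4.Eq2.43** = displays (2.43)–(2.48), the one §A definition row of [B4] that the owner's reading-rule audit of 2026-08-23
(`lit-balaban-r01/AUDIT-B4-DEF-g42.md`) KEPT `typed-existing`; this file is member 2 of the three owed members named there).

WHAT IS PRINTED (p. 584, verbatim).  «We apply it to the basic equation (−Δ^ξ + m_j² + a_jQ_j^*Q_j)φ₀ = f. (2.44)  Defining the
propagator G_j, φ₀ = G_jf, we get
  Δ^ξ(p)φ̃₀(p) + a_ju_j(p) Σ_{l′} \overline{u_j(p′+l′)} φ̃₀(p′+l′) = f̃(p),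
  u_j(p) = Π_{μ=1}^d (e^{−ip_μ} − 1)/((e^{−iξp_μ} − 1)/ξ),   Δ^ξ(p) = Σ_{μ=1}^d |(e^{−iξp_μ} − 1)/ξ|² + m_j²,
  p′ ∈ [−π,π[^d,  l′ = (l′₁,…,l′_d),  l′_μ = 2πm′_μ,  m′_μ is an integer,  −(L^j−1)/2 ≦ m′_μ ≦ (L^j−1)/2 for L odd,
  −L^j/2 ≦ m′_μ < L^j/2 for L even. (2.45)
Solving this equation we obtain the following formula:
  φ̃₀(p′+l) = (1/Δ^ξ(p′+l)) f̃(p′+l) − (u_j(p′+l)/Δ^ξ(p′+l)) · a_j/(a_j Σ_{l′} |u_j(p′+l′)|²/Δ^ξ(p′+l′) + 1) ·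
            Σ_{l′} (\overline{u_j(p′+l′)}/Δ^ξ(p′+l′)) f̃(p′+l′). (2.46)»
(In (2.45) the unknown is the family of values φ̃₀(p′+l′) at ONE reduced momentum p′: p = p′ + l, and u_j(p), Δ^ξ(p), f̃(p)
are data on the finite set of shifts l′.)

WHAT THIS MODULE PROVES (kernel-checked; 2 definitions WITH BODIES + theorems; 0 `sorry`; 0 `Prop` facts; axioms standard).
For a fixed reduced momentum p′, (2.45) is a RANK-ONE PERTURBATION OF A DIAGONAL SYSTEM on the finite fibre of shifts.  Over an
arbitrary finite index type `ι` (print's instance: the L^{jd} shifts l′; the tree's `k : Fin d → Fin n` of `B4StripSums` /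
`B4Green244`, with `u k = V n k p′`, `Δ k = DeltaXi n m² (shift n k p′)`):
* `bracket246 a Δ u` = the printed bracket `a_j Σ_{l′} |u_j(p′+l′)|²/Δ^ξ(p′+l′) + 1`;
* `sol246 a Δ u f k` = THE RIGHT-HAND SIDE OF (2.46) WITH ITS BODY:
  `f k/Δ k − (u k/Δ k)·(a/bracket246)·Σ_{k′} (conj(u k′)/Δ k′)·f k′`;
* `sum_conj_mul_sol246` — the rank-one functional of the candidate: `Σ_{k′} conj(u k′)·sol246 k′ = S − (a/B)·S·T`
  (`S = Σ conj(u)f/Δ`, `T = Σ|u|²/Δ`, `B = bracket246`);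
* **`eq245_sol246`** — (2.46) SOLVES (2.45): if every `Δ k ≠ 0` and `bracket246 ≠ 0`, then for every `k`
  `Δ k·sol246 k + a·u k·Σ_{k′} conj(u k′)·sol246 k′ = f k`;
* **`sol246_unique`** — «Solving this equation»: every fibre solution `φ` of (2.45) EQUALS `sol246` under the same two
  non-vanishing conditions; `eq245_iff_sol246` packages both directions (so (2.46) is THE solution of (2.45) on the fibre);
* a closing `example` (ι = `Fin 2`, a = 1, Δ ≡ 1, u ≡ 1, f ≡ 1) shows the hypotheses are jointly satisfiable.

v1.1 (gen 43, APPEND-ONLY; the v1 declarations above are byte-identical) — **(2.47) p. 585 AS THE RANK-ONE SPECIALISATION OF (2.46)**.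
Print (p. 585, verbatim; render `…-p015-x2.png` read as an image): «To calculate G_jQ_j^*, we take f = Q_j^*g in this formula, g is a
function on the unit lattice, f̃(p) = u_j(p)g̃(p′), g̃(p′) = Σ_y e^{−ip′·y}g(y), and we get
  (G_jQ_j^*g)~(p′+l) = (u_j(p′+l)/Δ^ξ(p′+l)) · 1/(a_j Σ_{l′} |u_j(p′+l′)|²/Δ^ξ(p′+l′) + 1) · g̃(p′). (2.47)»
On the fibre this is the datum `f k = u k · c` with the scalar `c = g̃(p′)` (the transform-side identity `f̃ = u_j·g̃` for
`f = Q_j^*g` is `B4Eq245Aliasing.ftSum_blockConst`, p24 gen 23), and (2.46) collapses: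
* `sum_conj_div_mul_blockConst` — `Σ_{k′} (conj(u k′)/Δ k′)·(u k′·c) = (Σ_{k′} |u k′|²/Δ k′)·c`;
* **`sol246_blockConst`** — (2.47) WITH ITS BODY as a kernel identity: if `bracket246 a Δ u ≠ 0` then for every `k`
  `sol246 a Δ u (fun k′ => u k′ * c) k = u k/Δ k · (bracket246 a Δ u)⁻¹ · c`
  (literally `u_j(p′+l)/Δ^ξ(p′+l) · 1/(a_jΣ_{l′}|u_j(p′+l′)|²/Δ^ξ(p′+l′) + 1) · g̃(p′)`);
* `eq245_blockConst` — this family solves (2.45) with `f k = u k·c` (both non-vanishing conditions), and `blockConst_unique` —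
  it is the only fibre solution (so, with `sol246_unique`, (2.47) is THE transform of `G_jQ_j^*g` on each fibre once (2.44) ⇒ (2.45)
  is supplied for `φ₀ = G_jQ_j^*g`; the position-space form (2.48) and its verification are `B4Green244.K_eq` / `green244`).

DICTIONARY / HONEST SCOPE.  (i) Pure finite-dimensional algebra over ℂ (Sherman–Morrison for `diag(Δ) + a·u ⊗ ū`): NO Fourier
transform is taken here — the passage (2.44) ⇒ (2.45) for a general finitely supported φ₀ (the aliasing identity of `Q_j^*Q_j`) and
the transform pair (2.43) are NOT in this file (the other two owed members of row B4.Eq2.43, `AUDIT-B4-DEF-g42.md` §Plan); the converse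
direction «(2.48) solves (2.44) for f = Q_j^*δ» is `B4Green244.green244` / `opD_Gfull`, torus `B4TorusGreen244.torusGreen244`.
(ii) `|u_j(p′+l′)|²` is written `(‖u k′‖ : ℂ)^2` (= `conj(u k′)·u k′`, `Complex.conj_mul'`).  (iii) `a_j ↦` any complex `a` (print:
real `a_j > 0`); `Δ`, `u`, `f` arbitrary functions on the fibre; print's non-vanishing of `Δ^ξ` (m_j² > 0 or p ≠ 0) and of the
bracket (a_j > 0, Δ^ξ > 0) hold on its instance and are proved where the tree uses them (`B4Strip.E_re_ge`, regrouped form) — cited,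
not re-proved.  Value = kernel certificate of one printed step of [B4] §2; NOT summit progress.
-/

namespace Literature.MathematicalPhysics.QuantumFieldTheory.Balaban1983to89.B4Eq246Fibre

open Finset
open scoped ComplexConjugate BigOperators

variable {ι : Type*} [Fintype ι]

/-- the printed bracket of (2.46): `a_j Σ_{l′} |u_j(p′+l′)|²/Δ^ξ(p′+l′) + 1` (on the finite fibre of shifts `ι`).
[cite: Balaban1983RegularityDecay, (2.46) p.584] -/
noncomputable def bracket246 (a : ℂ) (Δ u : ι → ℂ) : ℂ :=
  a * ∑ k, ((‖u k‖ : ℂ) ^ 2) / Δ k + 1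

/-- **(2.46) WITH ITS BODY** on the fibre of a fixed reduced momentum `p′`:
`φ̃₀(p′+l) = f̃(p′+l)/Δ^ξ(p′+l) − (u_j(p′+l)/Δ^ξ(p′+l))·a_j/(a_jΣ_{l′}|u_j(p′+l′)|²/Δ^ξ(p′+l′) + 1)·Σ_{l′}(ū_j(p′+l′)/Δ^ξ(p′+l′)) f̃(p′+l′)`
(`k ↔ l`, `k′ ↔ l′`). [cite: Balaban1983RegularityDecay, (2.46) p.584] -/
noncomputable def sol246 (a : ℂ) (Δ u f : ι → ℂ) (k : ι) : ℂ :=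
  f k / Δ k - u k / Δ k * (a / bracket246 a Δ u) * ∑ k', conj (u k') / Δ k' * f k'

/-- unfolding of `sol246`. [cite: Balaban1983RegularityDecay, (2.46) p.584] -/
theorem sol246_apply (a : ℂ) (Δ u f : ι → ℂ) (k : ι) :
    sol246 a Δ u f k
      = f k / Δ k - u k / Δ k * (a / bracket246 a Δ u) * ∑ k', conj (u k') / Δ k' * f k' := rfl

omit [Fintype ι] in
/-- `conj(u)·(u/Δ) = |u|²/Δ` termwise (print's `|u_j(p′+l′)|²/Δ^ξ(p′+l′)`). [cite: Balaban1983RegularityDecay, (2.46) p.584] -/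
theorem conj_mul_div (u Δ : ι → ℂ) (k : ι) :
    conj (u k) * (u k / Δ k) = ((‖u k‖ : ℂ) ^ 2) / Δ k := by
  rw [← mul_div_assoc, Complex.conj_mul']

/-- THE RANK-ONE FUNCTIONAL OF THE CANDIDATE: `Σ_{k′} conj(u k′)·sol246 k′ = S − (a/B)·S·T` with `S = Σ conj(u)f/Δ`,
`T = Σ |u|²/Δ`, `B = bracket246`. [cite: Balaban1983RegularityDecay, (2.45)–(2.46) p.584] -/
theorem sum_conj_mul_sol246 (a : ℂ) (Δ u f : ι → ℂ) :
    ∑ k', conj (u k') * sol246 a Δ u f k'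
      = (∑ k', conj (u k') / Δ k' * f k')
        - a / bracket246 a Δ u * (∑ k', conj (u k') / Δ k' * f k') * ∑ k', ((‖u k'‖ : ℂ) ^ 2) / Δ k' := by
  set S := ∑ k', conj (u k') / Δ k' * f k' with hS
  set c := a / bracket246 a Δ u with hc
  have hterm : ∀ k', conj (u k') * sol246 a Δ u f k'
      = conj (u k') / Δ k' * f k' - c * S * (((‖u k'‖ : ℂ) ^ 2) / Δ k') := by
    intro k'
    rw [sol246_apply, ← hS, ← hc, mul_sub]
    have h1 : conj (u k') * (f k' / Δ k') = conj (u k') / Δ k' * f k' := by ring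
    have h2 : conj (u k') * (u k' / Δ k' * c * S) = c * S * (conj (u k') * (u k' / Δ k')) := by ring
    rw [h1, h2, conj_mul_div]
  simp_rw [hterm]
  rw [Finset.sum_sub_distrib, ← Finset.mul_sum]

/-- **(2.46) SOLVES (2.45) ON THE FIBRE**: with `Δ k ≠ 0` for all `k` and the printed bracket non-zero,
`Δ^ξ(p′+l)φ̃₀(p′+l) + a_ju_j(p′+l)Σ_{l′} ū_j(p′+l′)φ̃₀(p′+l′) = f̃(p′+l)` for the `φ̃₀` of (2.46).
[cite: Balaban1983RegularityDecay, (2.45)–(2.46) p.584] -/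
theorem eq245_sol246 (a : ℂ) {Δ : ι → ℂ} (u f : ι → ℂ) (hΔ : ∀ k, Δ k ≠ 0) (hB : bracket246 a Δ u ≠ 0) (k : ι) :
    Δ k * sol246 a Δ u f k + a * u k * ∑ k', conj (u k') * sol246 a Δ u f k' = f k := by
  rw [sum_conj_mul_sol246, sol246_apply]
  set S := ∑ k', conj (u k') / Δ k' * f k' with hS
  set T := ∑ k', ((‖u k'‖ : ℂ) ^ 2) / Δ k' with hT
  have hBdef : bracket246 a Δ u = a * T + 1 := by rw [bracket246, hT]
  have hk := hΔ k
  -- clear the two divisions by `Δ k` and the division by the bracket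
  have e1 : Δ k * (f k / Δ k) = f k := by field_simp
  have e2 : Δ k * (u k / Δ k * (a / bracket246 a Δ u) * S) = u k * (a / bracket246 a Δ u) * S := by
    field_simp
  have e3 : a / bracket246 a Δ u * bracket246 a Δ u = a := div_mul_cancel₀ a hB
  calc Δ k * (f k / Δ k - u k / Δ k * (a / bracket246 a Δ u) * S)
        + a * u k * (S - a / bracket246 a Δ u * S * T)
      = Δ k * (f k / Δ k) - Δ k * (u k / Δ k * (a / bracket246 a Δ u) * S)
        + a * u k * (S - a / bracket246 a Δ u * S * T) := by ring
    _ = f k - u k * (a / bracket246 a Δ u) * S + a * u k * (S - a / bracket246 a Δ u * S * T) := by rw [e1, e2]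
    _ = f k + u k * S * (a - a / bracket246 a Δ u * (a * T + 1)) := by ring
    _ = f k + u k * S * (a - a / bracket246 a Δ u * bracket246 a Δ u) := by rw [hBdef]
    _ = f k := by rw [e3]; ring

/-- **«SOLVING THIS EQUATION»: EVERY FIBRE SOLUTION OF (2.45) IS (2.46)** (uniqueness under the same two non-vanishing
conditions): if `Δ kφ k + a·u k·Σ_{k′}conj(u k′)φ k′ = f k` for all `k`, then `φ = sol246 a Δ u f`.
[cite: Balaban1983RegularityDecay, (2.45)–(2.46) p.584] -/
theorem sol246_unique (a : ℂ) {Δ : ι → ℂ} (u f φ : ι → ℂ) (hΔ : ∀ k, Δ k ≠ 0) (hB : bracket246 a Δ u ≠ 0)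
    (h : ∀ k, Δ k * φ k + a * u k * ∑ k', conj (u k') * φ k' = f k) : φ = sol246 a Δ u f := by
  set X := ∑ k', conj (u k') * φ k' with hX
  set S := ∑ k', conj (u k') / Δ k' * f k' with hS
  set T := ∑ k', ((‖u k'‖ : ℂ) ^ 2) / Δ k' with hT
  have hBdef : bracket246 a Δ u = a * T + 1 := by rw [bracket246, hT]
  -- each unknown in terms of the functional `X`
  have hφ : ∀ k, φ k = f k / Δ k - a * (u k / Δ k) * X := by
    intro k
    have hk := hΔ k
    have := h k
    field_simp
    linear_combination this
  -- the functional solves a scalar equation: `X = S − a·T·X`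
  have hXeq : X = S - a * T * X := by
    have hterm : ∀ k', conj (u k') * φ k' = conj (u k') / Δ k' * f k' - a * X * (((‖u k'‖ : ℂ) ^ 2) / Δ k') := by
      intro k'
      rw [hφ k', mul_sub]
      have h1 : conj (u k') * (f k' / Δ k') = conj (u k') / Δ k' * f k' := by ring
      have h2 : conj (u k') * (a * (u k' / Δ k') * X) = a * X * (conj (u k') * (u k' / Δ k')) := by ring
      rw [h1, h2, conj_mul_div]
    calc X = ∑ k', conj (u k') * φ k' := hX
      _ = ∑ k', (conj (u k') / Δ k' * f k' - a * X * (((‖u k'‖ : ℂ) ^ 2) / Δ k')) := by simp_rw [hterm]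
      _ = S - a * X * T := by rw [Finset.sum_sub_distrib, ← Finset.mul_sum]
      _ = S - a * T * X := by ring
  have hXsol : X = S / bracket246 a Δ u := by
    rw [hBdef]
    have hB' : a * T + 1 ≠ 0 := by rw [← hBdef]; exact hB
    field_simp
    linear_combination hXeq
  funext k
  rw [sol246_apply, ← hS, hφ k, hXsol]
  have hk := hΔ k
  field_simp

/-- (2.45) on the fibre ⟺ (2.46), under `Δ ≠ 0` and the bracket `≠ 0`. [cite: Balaban1983RegularityDecay, (2.45)–(2.46) p.584] -/
theorem eq245_iff_sol246 (a : ℂ) {Δ : ι → ℂ} (u f φ : ι → ℂ) (hΔ : ∀ k, Δ k ≠ 0) (hB : bracket246 a Δ u ≠ 0) :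
    (∀ k, Δ k * φ k + a * u k * ∑ k', conj (u k') * φ k' = f k) ↔ φ = sol246 a Δ u f := by
  constructor
  · exact sol246_unique a u f φ hΔ hB
  · rintro rfl k
    exact eq245_sol246 a u f hΔ hB k

/-- non-vacuity of the binders: on `ι = Fin 2` with `a = 1`, `Δ ≡ 1`, `u ≡ 1` both hypotheses hold (bracket `= 3`).
[cite: Balaban1983RegularityDecay, (2.46) p.584, dictionary] -/
example : (∀ k : Fin 2, (fun _ => (1 : ℂ)) k ≠ 0) ∧ bracket246 (1 : ℂ) (fun _ : Fin 2 => (1 : ℂ)) (fun _ => 1) ≠ 0 := by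
  refine ⟨fun _ => one_ne_zero, ?_⟩
  rw [bracket246]
  norm_num

/-! ### v1.1 — (2.47) p. 585: the rank-one specialisation `f = Q_j^*g`, i.e. `f̃(p′+l′) = u_j(p′+l′)·g̃(p′)` on the fibre -/

/-- for the datum `f k′ = u k′·c` the rank-one functional of (2.46) collapses:
`Σ_{k′} (conj(u k′)/Δ k′)·(u k′·c) = (Σ_{k′} |u k′|²/Δ k′)·c` (print p. 585: `f̃(p) = u_j(p)g̃(p′)` inserted in (2.46)).
[cite: Balaban1983RegularityDecay, (2.46) p.584, (2.47) p.585] -/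
theorem sum_conj_div_mul_blockConst (Δ u : ι → ℂ) (c : ℂ) :
    ∑ k', conj (u k') / Δ k' * (u k' * c) = (∑ k', ((‖u k'‖ : ℂ) ^ 2) / Δ k') * c := by
  rw [Finset.sum_mul]
  refine Finset.sum_congr rfl fun k' _ => ?_
  have h : conj (u k') / Δ k' * (u k' * c) = conj (u k') * (u k' / Δ k') * c := by ring
  rw [h, conj_mul_div]

/-- **(2.47) WITH ITS BODY, AS THE RANK-ONE SPECIALISATION OF (2.46)**: «To calculate G_jQ_j^*, we take f = Q_j^*g in this
formula, […] f̃(p) = u_j(p)g̃(p′), […] and we get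
(G_jQ_j^*g)~(p′+l) = (u_j(p′+l)/Δ^ξ(p′+l)) · 1/(a_jΣ_{l′}|u_j(p′+l′)|²/Δ^ξ(p′+l′) + 1) · g̃(p′) (2.47)» — on the fibre of a reduced
momentum `p′`, with `c = g̃(p′)`: `sol246 a Δ u (k′ ↦ u k′·c) k = (u k/Δ k)·(bracket246 a Δ u)⁻¹·c`, provided the printed bracket
is non-zero. [cite: Balaban1983RegularityDecay, (2.47) p.585] -/
theorem sol246_blockConst (a : ℂ) (Δ u : ι → ℂ) (c : ℂ) (hB : bracket246 a Δ u ≠ 0) (k : ι) :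
    sol246 a Δ u (fun k' => u k' * c) k = u k / Δ k * (bracket246 a Δ u)⁻¹ * c := by
  rw [sol246_apply, sum_conj_div_mul_blockConst]
  set T := ∑ k', ((‖u k'‖ : ℂ) ^ 2) / Δ k' with hT
  have hBdef : bracket246 a Δ u = a * T + 1 := by rw [bracket246, hT]
  rw [hBdef] at hB ⊢
  field_simp
  ring

/-- the (2.47) family SOLVES (2.45) with the datum `f k = u k·c` (under `Δ ≠ 0` and the bracket `≠ 0`):
`Δ k·φ k + a·u k·Σ_{k′} conj(u k′)·φ k′ = u k·c` for `φ k = (u k/Δ k)·(bracket246)⁻¹·c`.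
[cite: Balaban1983RegularityDecay, (2.45) p.584, (2.47) p.585] -/
theorem eq245_blockConst (a : ℂ) {Δ : ι → ℂ} (u : ι → ℂ) (c : ℂ) (hΔ : ∀ k, Δ k ≠ 0) (hB : bracket246 a Δ u ≠ 0)
    (k : ι) :
    Δ k * (u k / Δ k * (bracket246 a Δ u)⁻¹ * c)
        + a * u k * ∑ k', conj (u k') * (u k' / Δ k' * (bracket246 a Δ u)⁻¹ * c) = u k * c := by
  have h := eq245_sol246 a u (fun k' => u k' * c) hΔ hB k
  simp_rw [sol246_blockConst a Δ u c hB] at h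
  exact h

/-- … and it is THE ONLY fibre solution of (2.45) with that datum («Solving this equation», specialised): every `φ` with
`Δ k·φ k + a·u k·Σ_{k′} conj(u k′)·φ k′ = u k·c` for all `k` is `φ k = (u k/Δ k)·(bracket246)⁻¹·c`.
[cite: Balaban1983RegularityDecay, (2.45)–(2.46) p.584, (2.47) p.585] -/
theorem blockConst_unique (a : ℂ) {Δ : ι → ℂ} (u φ : ι → ℂ) (c : ℂ) (hΔ : ∀ k, Δ k ≠ 0) (hB : bracket246 a Δ u ≠ 0)
    (h : ∀ k, Δ k * φ k + a * u k * ∑ k', conj (u k') * φ k' = u k * c) (k : ι) :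
    φ k = u k / Δ k * (bracket246 a Δ u)⁻¹ * c := by
  have hφ := sol246_unique a u (fun k' => u k' * c) φ hΔ hB h
  rw [hφ, sol246_blockConst a Δ u c hB]

/-- non-vacuity of the v1.1 binders: on `ι = Fin 2`, `a = 1`, `Δ ≡ 1`, `u ≡ 1`, `c = 3` the bracket is `3 ≠ 0` and (2.47) reads
`φ k = 1`. [cite: Balaban1983RegularityDecay, (2.47) p.585, dictionary] -/
example : sol246 (1 : ℂ) (fun _ : Fin 2 => (1 : ℂ)) (fun _ => 1) (fun k' => (fun _ => (1 : ℂ)) k' * 3) 0 = 1 := by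
  have hB : bracket246 (1 : ℂ) (fun _ : Fin 2 => (1 : ℂ)) (fun _ => 1) ≠ 0 := by
    rw [bracket246]; norm_num
  rw [sol246_blockConst (1 : ℂ) (fun _ : Fin 2 => (1 : ℂ)) (fun _ => 1) 3 hB 0, bracket246]
  norm_num

end Literature.MathematicalPhysics.QuantumFieldTheory.Balaban1983to89.B4Eq246Fibre
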